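import Literature.Analysis.FluidPDE.FractionalNSReynoldsPerturb
import Literature.Analysis.FluidPDE.CLCutoffs
import HarnessLib

/-!
# Luo–Titi 2020, Lemma 1: reduction of the Iteration Lemma on the time line to one cut-off step
  in a time slab

Analysis/FluidPDE proofs-only file (everything proved; no definitions, no named facts) for the
Iteration Lemma of T. Luo and E. S. Titi, *Non-uniqueness of weak solutions to hyperviscous
Navier–Stokes equations: on sharpness of J.-L. Lions exponent*, Calc. Var. PDE 59 (2020) =
arXiv:1808.07595, §2.1, Lemma 1 (`Torus.LuoTiti2020_iterationLemma` of `FluidPDE/FractionalNSReynolds`).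

The analytic core of the printed proof (§3) produces the new pair `(v_{q+1}, R_{q+1})` from a
temporal cut-off `ψ` fixed at the start of §3.3: "Let `ψ(t)` be a smooth cut-off function such
that `ψ = 1` on `supp_t R_q`, `supp ψ ⊂ N_{δ_{q+1}}(supp_t R_q)`", after which
`supp_t w_{q+1} ⊂ supp ψ` ((3.13)) and "`supp_t R_{q+1} ⊂ supp_t w_{q+1} ∪ supp_t R_q ⊂
N_{δ_{q+1}}(supp_t R_q)`" (§3.5, last display before the choice of parameters). In the tree this
core is organised on a time SLAB `[0, T]` (the intermittent-jet datum `JetStep.Datum` of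
`FluidPDE/JetPerturbation` and Luo–Titi's set-up `LuoTiti.Setup` of `FluidPDE/LuoTitiPerturbation`
carry a horizon `T` and ask `tsupport ψ ⊆ (0, T)`), whereas Lemma 1 is stated on the whole time
line for data of bounded temporal support. This file proves, once and for all, the soft
bookkeeping that separates the two:

* `Torus.exists_slabCutoff` — for a bounded set `K ⊆ ℝ` and `δ > 0` there are a shift `c`, a
  horizon `T > 0` and `ψ ∈ C^∞(ℝ; [0, 1])` with `ψ(s + c) = 1` for `s ∈ K`,
  `tsupport ψ ⊆ (0, T)` and `tsupport ψ ⊆ c + N_δ(K)` (smooth Urysohn on `ℝ`,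
  `CL22.exists_contDiff_zero_one_of_isClosed`, applied to `closure K ⊆ N_{δ/2}(K)`);
* `Torus.LuoTiti2020_iterationLemma_of_cutoffStep` — **Lemma 1 follows from the cut-off step
  in a slab**: if for every `θ ∈ [1, 5/4)`, `ν > 0` there is `C > 0` such that for every horizon
  `T > 0`, every smooth solution `(v, p, R)` of (2.1) on `ℝ × 𝕋³` with `‖R‖_{L^∞_t L¹_x} ≤ δ₁`,
  every admissible cut-off `ψ` (smooth, values in `[0,1]`, `tsupport ψ ⊆ (0,T)`, `ψ(t) = 1` or
  `R(t) = 0` at every `t` — exactly the fields `hψ, hψ01, hψsupp, hψM` of `LuoTiti.Setup.Valid`)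
  and every `δ₂ > 0` there is a smooth solution `(v', p', R')` of (2.1) on `ℝ × 𝕋³` with
  `‖R'‖_{L^∞_t L¹_x} ≤ δ₂`, `v' = v` and `R' = 0` off `tsupport ψ`,
  `‖v'(t) - v(t)‖_{L²} ≤ C δ₁^{1/2}` and `‖v'(t) - v(t)‖_{L¹} ≤ δ₂` for all `t`, then
  `Torus.LuoTiti2020_iterationLemma` holds — by translating the data in time into a slab
  (`Torus.IsFracNSReynoldsOn.comp_sub_time`; the system is autonomous), choosing `ψ` by
  `exists_slabCutoff` for `K = supp_t R_q`, `δ = δ_{q+1}`, and translating back; (2.3) is the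
  inclusion `tsupport ψ ⊆ c + N_{δ_{q+1}}(supp_t R_q)`.

The hypothesis of the reduction is stated inline (a `∀ … ∃ …` binder, not a definition): it is
the statement the slab construction of `LuoTitiPerturbation` is built to deliver, and nothing in
this file is specific to the building blocks used there.

## References

* T. Luo, E. S. Titi, Calc. Var. PDE 59 (2020) = arXiv:1808.07595, §2.1 Lemma 1 with
  (2.1)–(2.5); §3.3 (the cut-off `ψ`), (3.13); §3.5 ("Finally, we estimate the time support of
  `R_{q+1}`"). [`LuoTiti2020`]
-/

noncomputable section

open MeasureTheory Set Filter Function Metric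
open scoped ENNReal NNReal ContDiff

namespace Literature.Analysis.FluidPDE

namespace Torus

open FunctionSpaces FunctionSpaces.Torus

/-! ## A temporal cut-off adapted to a bounded set, inside a slab -/

/-- **A smooth temporal cut-off adapted to a bounded set, placed in a slab.** For a bounded
`K ⊆ ℝ` and `δ > 0` there are a shift `c`, a horizon `T > 0` and `ψ ∈ C^∞(ℝ)` with values in
`[0, 1]`, `ψ(s + c) = 1` for all `s ∈ K`, `tsupport ψ ⊆ (0, T)` and `tsupport ψ ⊆ c + N_δ(K)`
(Luo–Titi's "`ψ = 1` on `supp_t R_q`, `supp ψ ⊂ N_{δ_{q+1}}(supp_t R_q)`", transported into a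
slab). Construction: smooth Urysohn for the disjoint closed sets `(N_{δ/2}(K))ᶜ` and
`closure K`, then `tsupport ⊆ closure N_{δ/2}(K) ⊆ N_δ(K)`, a bounded set, which a translation
places inside `(0, T)`. [cite: LuoTiti2020, §3.3 (display before (3.9))] -/
theorem exists_slabCutoff {K : Set ℝ} (hK : Bornology.IsBounded K) {δ : ℝ} (hδ : 0 < δ) :
    ∃ c T : ℝ, 0 < T ∧ ∃ ψ : ℝ → ℝ, ContDiff ℝ ∞ ψ ∧ (∀ t, 0 ≤ ψ t ∧ ψ t ≤ 1) ∧
      (∀ s ∈ K, ψ (s + c) = 1) ∧ tsupport ψ ⊆ Ioo 0 T ∧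
      tsupport ψ ⊆ (fun t => t + c) '' thickening δ K := by
  -- the open set `A = N_{δ/2}(K)` and a ball containing its closure
  set A : Set ℝ := thickening (δ / 2) K with hA_def
  have hA : IsOpen A := isOpen_thickening
  have hKA : closure K ⊆ A := closure_subset_thickening (half_pos hδ) K
  have hAb : Bornology.IsBounded (closure A) := hK.thickening.closure
  obtain ⟨r, hr0, hr⟩ := hAb.subset_ball_lt 0 0
  have hrA : ∀ x ∈ closure A, -r < x ∧ x < r := by
    intro x hx
    have := hr hx
    rw [Real.ball_eq_Ioo, zero_sub, zero_add] at this
    exact this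
  -- smooth Urysohn: `ψ₀ = 0` off `A`, `ψ₀ = 1` on `closure K`
  obtain ⟨ψ₀, hψ₀, h0, h1, h01⟩ := CL22.exists_contDiff_zero_one_of_isClosed hA.isClosed_compl isClosed_closure
    (disjoint_compl_left_iff_subset.2 hKA)
  have hsupp₀ : tsupport ψ₀ ⊆ closure A := by
    refine closure_minimal (fun x hx => ?_) isClosed_closure
    by_contra hxA
    exact hx (h0 (show x ∈ Aᶜ from fun h => hxA (subset_closure h)))
  -- translate by `c = r + 1` into the slab `(0, 2r + 2)`
  refine ⟨r + 1, 2 * r + 2, by linarith, fun t => ψ₀ (t - (r + 1)), hψ₀.comp (contDiff_id.sub contDiff_const),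
    fun t => h01 _, ?_, ?_, ?_⟩
  · intro s hs
    have : s + (r + 1) - (r + 1) = s := by ring
    show ψ₀ (s + (r + 1) - (r + 1)) = 1
    rw [this]
    exact h1 (subset_closure hs)
  · -- `tsupport ψ ⊆ (0, T)`
    have hcl : tsupport (fun t => ψ₀ (t - (r + 1))) ⊆ {t | t - (r + 1) ∈ closure A} := by
      refine closure_minimal (fun t ht => ?_) (isClosed_closure.preimage (continuous_id.sub continuous_const))
      have ht' : t - (r + 1) ∈ support ψ₀ := ht
      exact hsupp₀ (subset_closure ht')
    intro t ht
    obtain ⟨h₁, h₂⟩ := hrA _ (hcl ht)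
    constructor <;> linarith
  · -- `tsupport ψ ⊆ c + N_δ(K)`
    have hcl : tsupport (fun t => ψ₀ (t - (r + 1))) ⊆ {t | t - (r + 1) ∈ closure A} := by
      refine closure_minimal (fun t ht => ?_) (isClosed_closure.preimage (continuous_id.sub continuous_const))
      have ht' : t - (r + 1) ∈ support ψ₀ := ht
      exact hsupp₀ (subset_closure ht')
    have hAδ : closure A ⊆ thickening δ K :=
      (closure_thickening_subset_cthickening (δ / 2) K).trans (cthickening_subset_thickening' hδ (by linarith) K)
    intro t ht
    exact ⟨t - (r + 1), hAδ (hcl ht), by ring⟩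

/-! ## Lemma 1 from the cut-off step in a slab -/

local notation "𝕋³" => UnitAddTorus (Fin 3)
local notation "ℝ³" => EuclideanSpace ℝ (Fin 3)

/-- **Luo–Titi's Iteration Lemma follows from the cut-off step in a time slab.** Suppose that for
every `θ ∈ [1, 5/4)` and `ν > 0` there is `C > 0` such that: for every horizon `T > 0`, every
smooth solution `(v, p, R)` of the fractional Navier–Stokes–Reynolds system (2.1) on `ℝ × 𝕋³`
(`Torus.IsFracNSReynoldsOn univ`), every cut-off `ψ ∈ C^∞(ℝ; [0,1])` with `tsupport ψ ⊆ (0, T)`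
and `ψ(t) = 1 ∨ R(t) = 0` for all `t` ("`ψ = 1` on `supp_t R_q`"), and all `δ₁, δ₂ > 0` with
`‖R‖_{L^∞_t L¹_x} ≤ δ₁`, there is a smooth solution `(v', p', R')` of (2.1) on `ℝ × 𝕋³` with
`‖R'‖_{L^∞_t L¹_x} ≤ δ₂`, `v'(t) = v(t)` and `R'(t) = 0` for `t ∉ tsupport ψ`
("`supp_t w_{q+1} ⊂ supp ψ`", "`supp_t R_{q+1} ⊂ supp_t w_{q+1} ∪ supp_t R_q`"),
`‖v'(t) - v(t)‖_{L²} ≤ C δ₁^{1/2}` and `∫‖v'(t) - v(t)‖ ≤ δ₂` for every `t`. Then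
`Torus.LuoTiti2020_iterationLemma` holds: translate the data (bounded temporal support) in time so
that `N_{δ_{q+1}}(supp_t R_q)` lies in a slab `(0, T)` (the system is autonomous,
`IsFracNSReynoldsOn.comp_sub_time`), take `ψ` from `exists_slabCutoff`, apply the step and
translate back; (2.3) follows from `tsupport ψ ⊆ N_{δ_{q+1}}(supp_t R_q)` and
`supp_t v_q ⊆ N_{δ_{q+1}}(supp_t v_q)`. [cite: LuoTiti2020, §2.1 Lemma 1; §3.3 (3.13); §3.5 (temporal support of `R_{q+1}`)] -/
theorem LuoTiti2020_iterationLemma_of_cutoffStep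
    (hstep : ∀ θ ν : ℝ, 1 ≤ θ → θ < 5 / 4 → 0 < ν →
      ∃ C : ℝ, 0 < C ∧
        ∀ (T : ℝ) (v : ℝ → 𝕋³ → ℝ³) (p : ℝ → 𝕋³ → ℝ) (R : ℝ → 𝕋³ → Fin 3 → ℝ³) (ψ : ℝ → ℝ) (δ₁ δ₂ : ℝ),
          0 < T → IsFracNSReynoldsOn univ θ ν v p R →
          ContDiff ℝ ∞ ψ → (∀ t, 0 ≤ ψ t ∧ ψ t ≤ 1) → tsupport ψ ⊆ Ioo 0 T → (∀ t, ψ t = 1 ∨ R t = 0) →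
          0 < δ₁ → 0 < δ₂ → (∀ t, ∫ x, ‖R t x‖ ≤ δ₁) →
          ∃ (v' : ℝ → 𝕋³ → ℝ³) (p' : ℝ → 𝕋³ → ℝ) (R' : ℝ → 𝕋³ → Fin 3 → ℝ³),
            IsFracNSReynoldsOn univ θ ν v' p' R' ∧
            (∀ t, ∫ x, ‖R' t x‖ ≤ δ₂) ∧
            (∀ t, t ∉ tsupport ψ → v' t = v t ∧ R' t = 0) ∧
            (∀ t, eLpNorm (v' t - v t) 2 volume ≤ ENNReal.ofReal (C * Real.sqrt δ₁)) ∧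
            (∀ t, ∫ x, ‖v' t x - v t x‖ ≤ δ₂)) :
    LuoTiti2020_iterationLemma := by
  intro θ ν hθ1 hθ2 hν
  obtain ⟨C, hC, hS⟩ := hstep θ ν hθ1 hθ2 hν
  refine ⟨C, hC, fun v p R δ₁ δ₂ hsol hbdd hδ₁ hδ₂ hR => ?_⟩
  -- the cut-off adapted to `K = supp_t R`, inside a slab after the shift `c`
  set K : Set ℝ := support R with hK_def
  have hKb : Bornology.IsBounded K := hbdd.subset subset_union_right
  obtain ⟨c, T, hT, ψ, hψ, hψ01, hψK, hψT, hψδ⟩ := exists_slabCutoff hKb hδ₁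
  -- the translated data `t ↦ (v, p, R)(t - c)`
  have hsolc := hsol.comp_sub_time c
  have hψM : ∀ t, ψ t = 1 ∨ (fun t => R (t - c)) t = 0 := by
    intro t
    by_cases h : R (t - c) = 0
    · exact Or.inr h
    · left
      have := hψK (t - c) h
      rwa [sub_add_cancel] at this
  have hRc : ∀ t, ∫ x, ‖(fun t => R (t - c)) t x‖ ≤ δ₁ := fun t => hR (t - c)
  obtain ⟨v', p', R', hsol', hR', hoff, hL2, hL1⟩ :=
    hS T (fun t => v (t - c)) (fun t => p (t - c)) (fun t => R (t - c)) ψ δ₁ δ₂ hT hsolc hψ hψ01 hψT hψM hδ₁ hδ₂ hRc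
  -- translate back
  refine ⟨fun t => v' (t + c), fun t => p' (t + c), fun t => R' (t + c), ?_, fun t => hR' (t + c), ?_, ?_, ?_⟩
  · simpa only [sub_neg_eq_add] using hsol'.comp_sub_time (-c)
  · -- (2.3): temporal supports
    have key : ∀ t, t + c ∈ tsupport ψ → t ∈ thickening δ₁ (support v ∪ support R) := by
      intro t ht
      obtain ⟨s, hs, hst⟩ := hψδ ht
      have : s = t := by linarith
      subst this
      exact thickening_subset_of_subset δ₁ subset_union_right hs
    rintro t (ht | ht)
    · by_cases hm : t + c ∈ tsupport ψ
      · exact key t hm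
      · have h1 := (hoff (t + c) hm).1
        have h2 : v' (t + c) = v t := by rw [h1]; simp
        have hv : t ∈ support v := by
          rw [mem_support] at ht ⊢
          rwa [h2] at ht
        exact self_subset_thickening hδ₁ _ (Or.inl hv)
    · by_cases hm : t + c ∈ tsupport ψ
      · exact key t hm
      · exact absurd (hoff (t + c) hm).2 ht
  · -- (2.4)
    intro t
    have := hL2 (t + c)
    simpa only [add_sub_cancel_right] using this
  · -- (2.5) in `L¹`
    intro t
    have := hL1 (t + c)
    simpa only [add_sub_cancel_right] using this

end Torus

end Literature.Analysis.FluidPDE
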